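/-
Copyright (c) 2026. All rights reserved.
Released under Apache 2.0 license as described in the file LICENSE.
-/
import Literature.MathematicalPhysics.StatisticalMechanics.LennardJonesClusters
import Mathlib.MeasureTheory.Measure.Haar.Unique
import Mathlib.MeasureTheory.Measure.Haar.InnerProductSpace
import Summits.AtomisticToContinuum.Crystallization.Theorems.PerronTransitivityUniformBindingRigidityCohesionL

-- PART A (lines 1–302 of lens-1 g36 `land/ContactSaturationLadderSparseRungs.lean`, sha256 a2ade6105312f4bd…): §1–§5 (Abel summation, net count,
-- multiplicity rung theorem, thresholds at γ = 5/7); PART B (`…SparseRungsB`) = §6–§8 (rung 2 at R = 7/5). Split for the 400-line rule by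
-- prover hand 1, gen 11 (--supports stmt-AtomisticToContinuum-30303); declarations byte-identical; the module docstring is repeated in B.

/-!
# Contact-saturation ladder — the SPARSE RUNG THEOREMS: `S_R(m) ≤ m·(206/5)·R⁻⁶` (every rung, every radius) and `S_{7/5}(2) ≤ 7.34`

Packing constants of the sparse ladder of route `ContactSaturationLadder`, crux `LooseTextureRung` (lens node `SparseShellSumR R m S`:
for a finite index set `A` of an injective configuration `y : Fin N → ℝ³` none of whose particles has `≥ m` OTHER particles within
distance `≤ R`, and `a ∈ A`, the far shell sum `S = Σ_{b ∈ A∖a, |y_a − y_b| > R} |y_a − y_b|⁻⁶`).  Two theorems, both GS-free, `N`-uniform,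
pure geometry:

* **Multiplicity rung** (`shellSum_le_mul`, `shellSum_le_mul_of_coord`; NO hard core used): `S_R(m) ≤ m · 206/(5R⁶)`
  (`R = 7/5`: `5.4718·m`; `R = 21/10`: `0.48038·m`, `shellSum_le_mul_twentyone_tenths`).
  Proof — a NET instead of a colouring: in the shell `R < |q − y_a| ≤ t` take an `R`-separated subset `S` of maximal size; `{y_a} ∪ S` is
  `R`-separated in `B̄(y_a, t)`, so `|S| + 1 ≤ (2t/R + 1)³` (`card_le_of_separated_of_dist_le`); maximality makes `S` an `R`-net whose fibres
  have `≤ m` points; so `m + N(t) ≤ m(2t/R + 1)³` (`card_le_mul_of_net`), and the `K`-weighted discrete Abel summation (`sum_inv_pow_six_le_abelK`,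
  `K = m`, centre credit `m`; the layer-cake inequalities are cited from `…PerronTransitivityUniformBindingRigidityCohesionL`) gives `m·R⁻⁶ + Σ ≤ m·T(R,R)`, `T(δ,t) = 16/(δ³t³) + 18/(δ²t⁴) + 36/(5δt⁵) + t⁻⁶`, `T(R,R) − R⁻⁶ = (206/5)R⁻⁶`.
* **Rung 2 by molecules** (`shellSum_two_le`; hard core `7/10`): `S_{7/5}(2) ≤ (4/3)·T(7/5,7/5) − (7/5)⁻⁶ = 2590625/352947 = 7.3400`.
  Proof — the PAIRED packing count `3·N ≤ 4·(t/r + 1)³` (`card_le_paired`): particles with at most one partner within `< 2r` and hard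
  core `r`; orient each close pair by the index order, give the lower point its ball `B(·, r)` and the upper point its far HALF-ball (disjoint
  from the partner's ball: `le_dist_of_inner_nonneg`); a half-ball has half the volume (`volume_ball_le_two_mul_halfBall`, point reflection),
  upper points inject into lower points, so the mean credit is `≥ 3/4` of a ball.  Then Abel with `K = 4/3`.

## Consequences at the certified grade `γ = 5/7` (`ContactSaturationLadderCompetitorGrade.competitor_grade`), §5 and §8
The lens node's engine `sparseR_of_sparseShellSumR : SparseShellSumR R m S → Competitor γ → (m−1)/24 + S/12 < γ → UnmarkedChunkExclusionF
(coordMarkerR R m) δ` then closes: `SPARSE(2; δ)` for every `δ` (`threshold_pair_seven_fifths`: `0.6533 < 5/7`; it fails at `γ = 1/2`), and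
`SPARSE₂(m') = UnmarkedChunkExclusionF (coordMarkerR (21/10) m') 2` for every `m' ≤ 9` (`threshold_twentyone_tenths`: `0.6936 < 5/7`).
Previously proved: rung `1` of each family, modulo `Competitor (1/2)`.
-/

namespace Summit.AtomisticToContinuum.Crystallization.Theorems.ContactSaturationLadderSparseRungs

open scoped BigOperators Classical RealInnerProductSpace ENNReal
open Metric Module MeasureTheory
open Literature.MathematicalPhysics.StatisticalMechanics (card_le_of_separated_of_dist_le)
open Summit.AtomisticToContinuum.Crystallization.Theorems.PerronTransitivityUniformBindingRigidity (packing_mul_inv_pow_six_sub_le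
  packing_mul_inv_pow_six_le)

variable {N : ℕ}

/-! ## §1 The layer-cake inequalities are CITED from `…PerronTransitivityUniformBindingRigidity` (`CohesionL`):
`cube_mul_inv_pow_six_sub_le`, `sq_mul_inv_pow_six_sub_le`, `mul_inv_pow_six_sub_le`, `packing_mul_inv_pow_six_sub_le`
(`(2a/δ+1)³(a⁻⁶ − b⁻⁶) ≤ T(δ,a) − T(δ,b)`), `packing_mul_inv_pow_six_le` (`(2a/δ+1)³a⁻⁶ ≤ T(δ,a)`). -/

/-! ## §2 The `K`-weighted discrete Abel summation -/

/-- **Weighted discrete layer-cake (Abel) summation.** In a metric space let `s` be `n` points at distance `≥ R > 0` from `p`,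
`K ≥ 0` a weight and `m` a credit with `m ≤ K·(2R/δ + 1)³` and `m + #{q' ∈ s : d(q') ≤ d(q)} ≤ K·(2d(q)/δ + 1)³` for every
`q ∈ s` (`d = dist · p`).  Then `m·R⁻⁶ + Σ_{q ∈ s} d(q)⁻⁶ ≤ K·T(δ, R)` (induction on `n`, peeling a nearest point). [folklore] -/
theorem sum_inv_pow_six_le_abelK {α : Type*} [MetricSpace α] {δ : ℝ} (hδ : 0 < δ) {K : ℝ} (hK : 0 ≤ K) (p : α) :
    ∀ (n : ℕ) (s : Finset α) (m : ℕ) (R : ℝ), s.card = n → 0 < R →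
      (m : ℝ) ≤ K * (2 * R / δ + 1) ^ 3 →
      (∀ q ∈ s, R ≤ dist q p) →
      (∀ q ∈ s, (m : ℝ) + ((s.filter fun q' => dist q' p ≤ dist q p).card : ℝ) ≤
        K * (2 * dist q p / δ + 1) ^ 3) →
      (m : ℝ) * R⁻¹ ^ 6 + ∑ q ∈ s, (dist q p)⁻¹ ^ 6 ≤
        K * (16 / (δ ^ 3 * R ^ 3) + 18 / (δ ^ 2 * R ^ 4) + 36 / (5 * δ * R ^ 5) + 1 / R ^ 6) := by
  classical
  intro n
  induction n with
  | zero =>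
    intro s m R hs hR hm _ _
    rw [Finset.card_eq_zero.1 hs, Finset.sum_empty, add_zero]
    calc (m : ℝ) * R⁻¹ ^ 6 ≤ K * (2 * R / δ + 1) ^ 3 * R⁻¹ ^ 6 :=
          mul_le_mul_of_nonneg_right hm (by positivity)
      _ = K * ((2 * R / δ + 1) ^ 3 * R⁻¹ ^ 6) := by ring
      _ ≤ _ := mul_le_mul_of_nonneg_left (packing_mul_inv_pow_six_le hδ hR) hK
  | succ n ih =>
    intro s m R hs hR hm hfar hcount
    have hne : s.Nonempty := by rw [← Finset.card_pos, hs]; exact Nat.succ_pos n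
    obtain ⟨q₁, hq₁, hmin⟩ := s.exists_min_image (fun q => dist q p) hne
    have hRd : R ≤ dist q₁ p := hfar q₁ hq₁
    have hd0 : 0 < dist q₁ p := hR.trans_le hRd
    have hq₁f : q₁ ∈ s.filter (fun q' => dist q' p ≤ dist q₁ p) :=
      Finset.mem_filter.2 ⟨hq₁, le_rfl⟩
    have hcard₁ : (1 : ℝ) ≤ ((s.filter fun q' => dist q' p ≤ dist q₁ p).card : ℝ) := by
      exact_mod_cast Finset.card_pos.2 ⟨q₁, hq₁f⟩
    have hm' : ((m + 1 : ℕ) : ℝ) ≤ K * (2 * dist q₁ p / δ + 1) ^ 3 := by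
      have := hcount q₁ hq₁
      push_cast
      linarith
    have hs' : (s.erase q₁).card = n := by
      rw [Finset.card_erase_of_mem hq₁, hs]
      rfl
    have hfar' : ∀ q ∈ s.erase q₁, dist q₁ p ≤ dist q p := fun q hq =>
      hmin q (Finset.mem_of_mem_erase hq)
    have hcount' : ∀ q ∈ s.erase q₁, ((m + 1 : ℕ) : ℝ) +
        (((s.erase q₁).filter fun q' => dist q' p ≤ dist q p).card : ℝ) ≤
          K * (2 * dist q p / δ + 1) ^ 3 := by
      intro q hq
      have hqs : q ∈ s := Finset.mem_of_mem_erase hq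
      have hq₁mem : q₁ ∈ s.filter (fun q' => dist q' p ≤ dist q p) :=
        Finset.mem_filter.2 ⟨hq₁, hmin q hqs⟩
      have hc : (((s.erase q₁).filter fun q' => dist q' p ≤ dist q p).card : ℝ) + 1 =
          ((s.filter fun q' => dist q' p ≤ dist q p).card : ℝ) := by
        rw [Finset.filter_erase]
        exact_mod_cast Finset.card_erase_add_one hq₁mem
      have := hcount q hqs
      push_cast
      linarith
    have IH := ih (s.erase q₁) (m + 1) (dist q₁ p) hs' hd0 hm' hfar' hcount'
    have hKI := mul_le_mul_of_nonneg_left (packing_mul_inv_pow_six_sub_le hδ hR hd0) hK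
    have hmono : (dist q₁ p)⁻¹ ^ 6 ≤ R⁻¹ ^ 6 := by
      gcongr
    have h1 : (m : ℝ) * (R⁻¹ ^ 6 - (dist q₁ p)⁻¹ ^ 6) ≤
        K * (2 * R / δ + 1) ^ 3 * (R⁻¹ ^ 6 - (dist q₁ p)⁻¹ ^ 6) :=
      mul_le_mul_of_nonneg_right hm (sub_nonneg.2 hmono)
    have h1' : K * (2 * R / δ + 1) ^ 3 * (R⁻¹ ^ 6 - (dist q₁ p)⁻¹ ^ 6) =
        K * ((2 * R / δ + 1) ^ 3 * (R⁻¹ ^ 6 - (dist q₁ p)⁻¹ ^ 6)) := by ring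
    rw [← Finset.add_sum_erase s _ hq₁]
    push_cast at IH
    linarith

/-! ## §3 The net count: `m + |P| ≤ m·(2t/R + 1)³` -/

/-- **Net count.** Let `P ⊂ ℝ³` be a finite set of points in the shell `R ≤ |q − p| ≤ t` (`R > 0`) such that every `q ∈ P` has at most
`m` points of `P` (itself included) within distance `< R`.  Then `m + |P| ≤ m·(2t/R + 1)³`: a maximal `R`-separated `S ⊆ P` has
`|S| + 1 ≤ (2t/R + 1)³` (volumetric count of `{p} ∪ S`) and covers `P` by `< R`-balls with fibres of size `≤ m`. [folklore] -/
theorem card_le_mul_of_net (P : Finset (EuclideanSpace ℝ (Fin 3))) (p : EuclideanSpace ℝ (Fin 3)) {R t : ℝ} (hR : 0 < R)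
    (ht : 0 ≤ t) (m : ℕ) (hin : ∀ q ∈ P, dist q p ≤ t) (hfar : ∀ q ∈ P, R ≤ dist q p)
    (hdeg : ∀ q ∈ P, (P.filter fun q' => dist q' q < R).card ≤ m) :
    (m : ℝ) + (P.card : ℝ) ≤ m * (2 * t / R + 1) ^ 3 := by
  classical
  obtain ⟨S, hSmem, hSmax⟩ := (P.powerset.filter fun S => ∀ c ∈ S, ∀ d ∈ S, c ≠ d → R ≤ dist c d).exists_max_image
    Finset.card ⟨∅, Finset.mem_filter.2 ⟨Finset.mem_powerset.2 (Finset.empty_subset _), by simp⟩⟩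
  have hSP : S ⊆ P := Finset.mem_powerset.1 (Finset.mem_filter.1 hSmem).1
  have hSsep : ∀ c ∈ S, ∀ d ∈ S, c ≠ d → R ≤ dist c d := (Finset.mem_filter.1 hSmem).2
  -- covering by maximality
  have hcov : ∀ q ∈ P, ∃ s ∈ S, dist q s < R := by
    intro q hq
    by_cases hqS : q ∈ S
    · exact ⟨q, hqS, by rw [dist_self]; exact hR⟩
    by_contra hno
    push Not at hno
    have hsep' : ∀ c ∈ insert q S, ∀ d ∈ insert q S, c ≠ d → R ≤ dist c d := by
      intro c hc d hd hcd
      rcases Finset.mem_insert.1 hc with rfl | hc' <;> rcases Finset.mem_insert.1 hd with rfl | hd'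
      · exact (hcd rfl).elim
      · exact hno d hd'
      · rw [dist_comm]; exact hno c hc'
      · exact hSsep c hc' d hd' hcd
    have hmem : insert q S ∈ P.powerset.filter fun S => ∀ c ∈ S, ∀ d ∈ S, c ≠ d → R ≤ dist c d :=
      Finset.mem_filter.2 ⟨Finset.mem_powerset.2 (Finset.insert_subset hq hSP), hsep'⟩
    have := hSmax _ hmem
    rw [Finset.card_insert_of_notMem hqS] at this
    omega
  -- the net is small
  have hpS : p ∉ S := by
    intro h
    have := hfar p (hSP h)
    rw [dist_self] at this
    linarith
  have hS1 : (S.card : ℝ) + 1 ≤ (2 * t / R + 1) ^ 3 := by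
    have hin' : ∀ c ∈ insert p S, dist c p ≤ t := by
      intro c hc
      rcases Finset.mem_insert.1 hc with rfl | hc
      · rw [dist_self]; exact ht
      · exact hin c (hSP hc)
    have hsep' : ∀ c ∈ insert p S, ∀ d ∈ insert p S, c ≠ d → R ≤ dist c d := by
      intro c hc d hd hcd
      rcases Finset.mem_insert.1 hc with rfl | hc' <;> rcases Finset.mem_insert.1 hd with rfl | hd'
      · exact (hcd rfl).elim
      · rw [dist_comm]; exact hfar d (hSP hd')
      · exact hfar c (hSP hc')
      · exact hSsep c hc' d hd' hcd
    have h := card_le_of_separated_of_dist_le (insert p S) p hR ht hin' hsep'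
    rw [finrank_euclideanSpace_fin, Finset.card_insert_of_notMem hpS] at h
    push_cast at h
    simpa using h
  -- fibres of the covering map have size ≤ m
  have hPS : (P.card : ℝ) ≤ m * S.card := by
    choose! f hf using hcov
    have key := Finset.card_le_mul_card_image_of_maps_to (f := f) (s := P) (t := S) (fun q hq => (hf q hq).1) m
      (by
        intro s hs
        calc (P.filter fun q => f q = s).card ≤ (P.filter fun q' => dist q' s < R).card := by
              apply Finset.card_le_card
              intro q hq
              rw [Finset.mem_filter] at hq ⊢
              exact ⟨hq.1, hq.2 ▸ (hf q hq.1).2⟩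
          _ ≤ m := hdeg s (hSP hs))
    exact_mod_cast key
  have hm0 : (0 : ℝ) ≤ m := Nat.cast_nonneg m
  calc (m : ℝ) + P.card ≤ m + m * S.card := by linarith
    _ = m * (S.card + 1) := by ring
    _ ≤ m * (2 * t / R + 1) ^ 3 := mul_le_mul_of_nonneg_left hS1 hm0

/-! ## §4 The multiplicity rung theorem -/

/-- **★ `S_R(m) ≤ m·(206/5)·R⁻⁶`.** For an injective configuration `y`, a finite index set `A` in which every `b ∈ A` has at most `m`
indices `l ∈ A` (itself included) with `|y_l − y_b| < R`, and any index `a`: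
`Σ_{b ∈ A∖a, |y_a − y_b| > R} |y_a − y_b|⁻⁶ ≤ m · 206/(5R⁶)`. [folklore: net count + Abel summation] -/
theorem shellSum_le_mul {R : ℝ} (hR : 0 < R) (m : ℕ) (y : Fin N → EuclideanSpace ℝ (Fin 3)) (hy : Function.Injective y)
    (A : Finset (Fin N)) (hdeg : ∀ b ∈ A, (A.filter fun l => dist (y l) (y b) < R).card ≤ m) (a : Fin N) :
    ∑ b ∈ (A.erase a).filter (fun b => R < dist (y a) (y b)), (dist (y a) (y b))⁻¹ ^ 6 ≤ m * (206 / (5 * R ^ 6)) := by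
  set B := (A.erase a).filter (fun b => R < dist (y a) (y b)) with hB
  set s : Finset (EuclideanSpace ℝ (Fin 3)) := B.image y with hs
  have hsum : ∑ b ∈ B, (dist (y a) (y b))⁻¹ ^ 6 = ∑ q ∈ s, (dist q (y a))⁻¹ ^ 6 := by
    rw [hs, Finset.sum_image (fun b _ c _ h => hy h)]
    exact Finset.sum_congr rfl fun b _ => by rw [dist_comm]
  have hfar : ∀ q ∈ s, R ≤ dist q (y a) := by
    intro q hq
    obtain ⟨b, hb, rfl⟩ := Finset.mem_image.1 hq
    rw [dist_comm]
    exact le_of_lt (Finset.mem_filter.1 hb).2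
  have hcount : ∀ q ∈ s, ((m : ℕ) : ℝ) + ((s.filter fun q' => dist q' (y a) ≤ dist q (y a)).card : ℝ) ≤
      (m : ℝ) * (2 * dist q (y a) / R + 1) ^ 3 := by
    intro q hq
    refine card_le_mul_of_net (s.filter fun q' => dist q' (y a) ≤ dist q (y a)) (y a) hR dist_nonneg m
      (fun q' hq' => (Finset.mem_filter.1 hq').2) (fun q' hq' => hfar q' (Finset.mem_filter.1 hq').1) ?_
    intro q' hq'
    obtain ⟨b', hb', rfl⟩ := Finset.mem_image.1 (Finset.mem_filter.1 hq').1
    have hb'A : b' ∈ A := (Finset.mem_erase.1 (Finset.mem_filter.1 hb').1).2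
    refine le_trans ?_ (hdeg b' hb'A)
    calc ((s.filter fun q' => dist q' (y a) ≤ dist q (y a)).filter fun q'' => dist q'' (y b') < R).card
          ≤ ((A.filter fun l => dist (y l) (y b') < R).image y).card := by
            apply Finset.card_le_card
            intro q'' hq''
            rw [Finset.mem_filter] at hq''
            obtain ⟨b'', hb'', rfl⟩ := Finset.mem_image.1 (Finset.mem_filter.1 hq''.1).1
            exact Finset.mem_image.2
              ⟨b'', Finset.mem_filter.2 ⟨(Finset.mem_erase.1 (Finset.mem_filter.1 hb'').1).2, hq''.2⟩, rfl⟩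
      _ ≤ _ := Finset.card_image_le
  have h27 : (2 * R / R + 1 : ℝ) ^ 3 = 27 := by
    rw [mul_div_assoc, div_self hR.ne']
    norm_num
  have hm : ((m : ℕ) : ℝ) ≤ (m : ℝ) * (2 * R / R + 1) ^ 3 := by
    rw [h27]
    exact le_mul_of_one_le_right (Nat.cast_nonneg _) (by norm_num)
  have hmain := sum_inv_pow_six_le_abelK hR (Nat.cast_nonneg m) (y a) s.card s m R rfl hR hm hfar hcount
  have hT : (m : ℝ) * (16 / (R ^ 3 * R ^ 3) + 18 / (R ^ 2 * R ^ 4) + 36 / (5 * R * R ^ 5) + 1 / R ^ 6) -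
      (m : ℝ) * R⁻¹ ^ 6 = m * (206 / (5 * R ^ 6)) := by
    field_simp
    ring
  rw [hsum]
  linarith

/-- **★ The same with the lens node's hypothesis shape** (`b ∉ coordMarkerR R m N y` unfolded): every `b ∈ A` has FEWER THAN `m` OTHER
particles (all of `Fin N` counted) within distance `≤ R`.  [This is `SparseShellSumR R m (m · 206/(5R⁶))` of the node, minus its
unused hard-core hypothesis.] -/
theorem shellSum_le_mul_of_coord {R : ℝ} (hR : 0 < R) (m : ℕ) (y : Fin N → EuclideanSpace ℝ (Fin 3))
    (hy : Function.Injective y) (A : Finset (Fin N))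
    (hA : ∀ b ∈ A, ¬ m ≤ (Finset.univ.filter fun l : Fin N => l ≠ b ∧ dist (y l) (y b) ≤ R).card) (a : Fin N) :
    ∑ b ∈ (A.erase a).filter (fun b => R < dist (y a) (y b)), (dist (y a) (y b))⁻¹ ^ 6 ≤ m * (206 / (5 * R ^ 6)) := by
  refine shellSum_le_mul hR m y hy A (fun b hb => ?_) a
  have hlt := not_le.1 (hA b hb)
  have hsub : (A.filter fun l => dist (y l) (y b) < R) ⊆
      insert b (Finset.univ.filter fun l : Fin N => l ≠ b ∧ dist (y l) (y b) ≤ R) := by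
    intro l hl
    rw [Finset.mem_insert, Finset.mem_filter]
    by_cases hlb : l = b
    · exact Or.inl hlb
    · exact Or.inr ⟨Finset.mem_univ _, hlb, le_of_lt (Finset.mem_filter.1 hl).2⟩
  calc (A.filter fun l => dist (y l) (y b) < R).card
        ≤ (insert b (Finset.univ.filter fun l : Fin N => l ≠ b ∧ dist (y l) (y b) ≤ R)).card := Finset.card_le_card hsub
    _ ≤ (Finset.univ.filter fun l : Fin N => l ≠ b ∧ dist (y l) (y b) ≤ R).card + 1 := Finset.card_insert_le _ _
    _ ≤ m := by omega

/-! ## §5 The two bond radii of the cut of record, and the rung thresholds at the certified grade `γ = 5/7` -/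

/-- `206/(5·(7/5)⁶) = 643750/117649` (`= 5.4718…`, the rung-1 constant). -/
theorem const_seven_fifths : (206 : ℝ) / (5 * (7 / 5) ^ 6) = 643750 / 117649 := by norm_num

/-- `206/(5·(21/10)⁶) = 41200000/85766121` (`= 0.48038…`). -/
theorem const_twentyone_tenths : (206 : ℝ) / (5 * (21 / 10) ^ 6) = 41200000 / 85766121 := by norm_num

/-- **`S_{7/5}(m) ≤ m · 643750/117649`.** -/
theorem shellSum_le_mul_seven_fifths (m : ℕ) (y : Fin N → EuclideanSpace ℝ (Fin 3)) (hy : Function.Injective y)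
    (A : Finset (Fin N))
    (hA : ∀ b ∈ A, ¬ m ≤ (Finset.univ.filter fun l : Fin N => l ≠ b ∧ dist (y l) (y b) ≤ 7 / 5).card) (a : Fin N) :
    ∑ b ∈ (A.erase a).filter (fun b => (7 : ℝ) / 5 < dist (y a) (y b)), (dist (y a) (y b))⁻¹ ^ 6 ≤
      m * (643750 / 117649) := by
  rw [← const_seven_fifths]
  exact shellSum_le_mul_of_coord (by norm_num) m y hy A hA a

/-- **`S_{21/10}(m) ≤ m · 41200000/85766121`.** -/
theorem shellSum_le_mul_twentyone_tenths (m : ℕ) (y : Fin N → EuclideanSpace ℝ (Fin 3)) (hy : Function.Injective y)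
    (A : Finset (Fin N))
    (hA : ∀ b ∈ A, ¬ m ≤ (Finset.univ.filter fun l : Fin N => l ≠ b ∧ dist (y l) (y b) ≤ 21 / 10).card) (a : Fin N) :
    ∑ b ∈ (A.erase a).filter (fun b => (21 : ℝ) / 10 < dist (y a) (y b)), (dist (y a) (y b))⁻¹ ^ 6 ≤
      m * (41200000 / 85766121) := by
  rw [← const_twentyone_tenths]
  exact shellSum_le_mul_of_coord (by norm_num) m y hy A hA a

/-- **Rung thresholds at `R = 21/10` with the certified grade `γ = 5/7`:** `(m − 1)/24 + m·(41200000/85766121)/12 < 5/7` for every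
`m ≤ 9` (`m = 9`: `0.69362 < 0.71428`; `m = 10` fails: `0.775`).  With the lens node's `sparseR_of_sparseShellSumR` and
`ContactSaturationLadderCompetitorGrade.competitor_grade` this closes `SPARSE₂(m')` for all `m' ≤ 9`. -/
theorem threshold_twentyone_tenths {m : ℕ} (hm : m ≤ 9) :
    ((m : ℝ) - 1) / 24 + m * (41200000 / 85766121 : ℝ) / 12 < 5 / 7 := by
  have h9 : (m : ℝ) ≤ 9 := by exact_mod_cast hm
  nlinarith

/-- **Rung thresholds at `R = 7/5` with `γ = 5/7`:** the multiplicity bound closes rung `1` only (`5.4718 < 60/7`; rung `2` would need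
`S(2) < 113/14 = 8.07` against `10.94`).  Recorded: the rung-1 inequality. -/
theorem threshold_seven_fifths_one : ((1 : ℝ) - 1) / 24 + 1 * (643750 / 117649 : ℝ) / 12 < 5 / 7 := by norm_num

end Summit.AtomisticToContinuum.Crystallization.Theorems.ContactSaturationLadderSparseRungs
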